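import Literature.Probability.Percolation.MeanClusterSizeExponentFromSeparation
import Literature.Probability.Percolation.TriThetaExponentFromSeparation
import Literature.Probability.Percolation.NearCriticalOneArmFromAltFacts
import HarnessLib

/-!
# `γ = 43/18` from `ν = 4/3` for ANY four-arm kernel; the alternating route; the complete list of inputs (proofs only)

Topic `Literature/Probability/Percolation`; family `crit-perc`, statement **crit-perc.S16**
(`Literature.Probability.Percolation.triMeanClusterSize_exponent`, `ArmExponents.lean`:
`χ^f(p) = |p - 1/2|^{-43/18 + o(1)}` as `p → 1/2`, S. Smirnov, W. Werner, *Critical exponents for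
two-dimensional percolation*, Math. Res. Lett. 8 (2001), Thm. 1 (ii); H. Kesten, *Scaling
relations for 2D-percolation*, Comm. Math. Phys. 109 (1987), Cor. 1: `γ = γ' = 43/18` given the
arm exponents). PROOFS ONLY: no definition, no named fact (D-0026). Sequel of
`MeanClusterSizeExponentAssembly.lean`, `MeanClusterSizeExponentFromFacts.lean` and
`MeanClusterSizeExponentFromSeparation.lean`.

## What this file does

The tree's assembly of `γ` (`triMeanClusterSize_exponent_of_powerBounds`,
`MeanClusterSizeExponentAssembly.lean`) reads the exponent `ν = 4/3` of Nolin's length `L_ε(p)`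
off the four-arm exponent `fourArm_exponent` and Kesten's relation `|p - 1/2| L² π₄(L) ≍ 1`
(`Nolin2008_prop34`), both written with the ORDER-FREE critical four-arm kernel
`π₄ = critFourArmProb` (`armEvent ![T,F,T,F]`, cyclic order of the colours not imposed). The
near-critical programme of the tree now runs along two parallel lines — the order-free one (ONE
separation hypothesis for `fourArmProbAt`: `KestenScalingFromSeparation.lean`,
`TriThetaExponentFromSeparation.lean`, `MeanClusterSizeExponentFromSeparation.lean`) and the
ALTERNATING one (Werner's `π̂_p`, Kesten's (1.12), Nolin's `σ = BWBW`: `AltFourArm.lean`,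
`NearCriticalOneArmFromAltFacts.lean`, `KestenScalingThetaFromKernel.lean`), which needs arm
separation for one colour sequence only. This file makes the discharge of
`triMeanClusterSize_exponent` independent of that choice, exactly as
`KestenScalingThetaFromKernel.lean` does for `Nolin2008_theta_asymp`:

* `tendsto_charLength_atTop_of_charLengthExponent`,
  `tendsto_log_triMeanClusterSize_div_log_of_charLengthExponent`,
  `triMeanClusterSize_exponent_of_powerBounds'` — the assembly of
  `MeanClusterSizeExponentAssembly.lean` with the pair (four-arm exponent, Kesten's relation at `ε`)
  replaced by its only use, the limit `log L_ε(p) / log |p - 1/2| → -4/3` (KERNEL-FREE);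
* `triMeanClusterSize_exponent_of_charLengthExponent_at`,
  `triMeanClusterSize_exponent_of_charLengthExponent` — **`γ = 43/18` from `oneArm_exponent`,
  `ν = 4/3` for `L_ε` at small `ε`, and Nolin's Thm. 27 (`j = 1`)** (the radius decay beyond
  `L_ε` being the tree's theorem `Nolin2008_lemma39_at_holds_small`);
* `tendsto_charLength_atTop_of_kernel_at`, `tendsto_log_charLength_div_log_of_kernel_at` —
  **`L_ε(p) → ∞` and `ν = 4/3` for any kernel `Q : ℕ → ℕ → ℝ` with values in `[0, 1]`** whose
  critical exponent is `5/4` (`log Q(r₀, N) / log N → -5/4` for all large `r₀`) and for which the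
  two-sided Kesten bounds `c ≤ |p - 1/2| L_ε(p)² Q(r₀, L_ε(p)) ≤ C` hold at `ε` (Nolin 2008, §7.3,
  display after Prop. 34, proof verbatim: `KestenScaling.lean`, `tendsto_log_charLength_div_log_at`
  is the case `Q = critFourArmProb`);
* `triMeanClusterSize_exponent_of_thm27_of_kernel` — `γ` from `oneArm_exponent`,
  `Nolin2008_thm27_oneArm` and the two kernel inputs; an `example` recovers
  `triMeanClusterSize_exponent_of_leaves4` at `Q = critFourArmProb`;
* `altFourArm_exponent_of_bridge` — the critical exponent `5/4` of the ALTERNATING kernel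
  `π̂^alt_{1/2}` from `fourArm_exponent` and the bridge `c π₄ ≤ π̂^alt_{1/2}` (Nolin 2008, §5.1,
  Prop. 20: any two non-constant colour sequences are comparable at `p = 1/2`; Smirnov–Werner 2001,
  §4: prescribing the order "will change `b_j` up to a multiplicative constant");
* `triMeanClusterSize_exponent_of_altHyps`, `triMeanClusterSize_exponent_of_scalingLimit_of_altHyps`
  — **the ALTERNATING route for `γ`**: `oneArm_exponent` (or LSW's two scaling-limit facts), the
  exponent `5/4` of `π̂^alt_{1/2}`, the three alternating hypotheses of
  `Nolin2008_thm27_oneArm_of_altHyps` (quasi-multiplicativity, a priori bound, interior pivotal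
  lower bound for `π̂^alt` below `L(p)`) and the two-sided Kesten bounds with the critical
  alternating kernel at small `ε`;
* `triMeanClusterSize_exponent_of_scalingLimits_of_separation` — **the ORDER-FREE route, complete
  list of inputs** (mirror of `triTheta_exponent_of_scalingLimits_of_separation`): the two LSW
  scaling-limit facts (`oneArm_exponent`), Smirnov–Werner's two continuum inputs for `j = 4`
  (`fourArm_exponent`), and near-critical four-arm separation below `L(p)`.

Everything is proved; no `sorry`, no new definition, no new named fact.

## References

* S. Smirnov, W. Werner, Critical exponents for two-dimensional percolation, *Math. Res. Lett.* 8
  (2001) 729–744, §2, Thm. 1 (ii) and the paragraph following Thm. 1; §4, Thm. 4, (9), (10), (16)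
  (arXiv math/0109120, pp. 4, 7) [SmirnovWernerMRL2001].
* H. Kesten, Scaling relations for 2D-percolation, *Comm. Math. Phys.* 109 (1987) 109–156, (1.12),
  Thm. 1, Cor. 1, Thm. 2, (4.5) [KestenScalingCMP1987].
* P. Nolin, Near-critical percolation in two dimensions, *Electron. J. Probab.* 13 (2008)
  1562–1623, §4.3 Thm. 11, §5.1 Prop. 20, §6.1 Thm. 27, §7.3 Prop. 34 and the display after it,
  §7.4 Lemma 39, §7.5 (arXiv 0711.4948: Thm. 10, Prop. 19, Thm. 26, Prop. 32, Lemma 37; §7.5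
  Lemma 42, Prop. 43 in the arXiv numbering) [Nolin2008].
* W. Werner, *Lectures on two-dimensional critical percolation*, IAS/Park City Math. Ser. 16
  (2009), Lecture 6, §3–§5, Prop. 6.1, Cor. 6.2, Lemma 6.2, Cor. 6.4 [WernerPCMI2009].
* G. F. Lawler, O. Schramm, W. Werner, One-arm exponent for critical 2D percolation, *Electron.
  J. Probab.* 7 (2002), Thm. 1.1, Thm. 1.2 [LawlerSchrammWernerEJP2002].

Tree: `triMeanClusterSize_powerLowerBound_of_sq_at`, `triMeanClusterSize_ge_sq_at`
(`MeanClusterSizeLowerBound.lean`), `triMeanClusterSize_le_rpow_at` (`MeanClusterSizeUpperBound.lean`),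
`triMeanClusterSize_exponent_of_separation` (`MeanClusterSizeExponentFromSeparation.lean`),
`Nolin2008_thm27_oneArm_of_altHyps` (`NearCriticalOneArmFromAltFacts.lean`),
`fourArm_exponent_of_scalingLimit_of_nearCritical_separation` (`TriThetaExponentFromSeparation.lean`),
`oneArm_exponent_of_scalingLimit'` (`OneArmLSWProofs.lean`), `Nolin2008_lemma39_at_holds_small`
(`NearCriticalRSWStart.lean`), `Nolin2008_radius_decay_at_of_lemma39_at'`, `eventually_nhdsNE_half`,
`tendsto_sub_half_nhdsNE`, `hasDecayExponent_eventually_pos` (`KestenScaling.lean`),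
`altFourArmProbAt_nonneg`, `altFourArmProbAt_le_one`, `altFourArmProbAt_le_fourArmProbAt`
(`AltFourArm.lean`), `fourArmProbAt_half` (`WernerPivotalEstimates.lean`). Mathlib: `Real.log`,
`Real.rpow`, order topology of `ℝ` (`Filter.Tendsto.neg_mul_atBot`, `Real.tendsto_log_nhdsGT_zero`).
-/

noncomputable section

open Filter Topology MeasureTheory Set
open scoped unitInterval ENNReal

namespace Literature.Probability.Percolation

open LatticeModels

/-! ### The assembly, kernel-free: `γ` from `ν = 4/3` and the power bounds -/

/-- **`L_ε(p) → ∞` as `p → 1/2` from `ν = 4/3`**: if `log L_ε(p) / log |p - 1/2| → -4/3` along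
`p → 1/2`, `p ≠ 1/2`, then `L_ε(p) → ∞` (`log |p - 1/2| → -∞`, so `log L_ε(p) → +∞`). Elementary;
Nolin 2008, §3.1 proves `L_ε(p) → ∞` directly. [cite: Nolin2008, §3.1 (Proposition: L → ∞) and §7.3 (display after Prop. 34)] -/
theorem tendsto_charLength_atTop_of_charLengthExponent {ε : ℝ}
    (hν : Tendsto (fun p : ℝ => Real.log (charLength ε (projIcc (0 : ℝ) 1 zero_le_one p) : ℝ) /
      Real.log |p - 1 / 2|) (𝓝[≠] (1 / 2)) (𝓝 (-(4 / 3)))) :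
    Tendsto (fun p : ℝ => charLength ε (projIcc (0 : ℝ) 1 zero_le_one p)) (𝓝[≠] (1 / 2)) atTop := by
  set l : Filter ℝ := 𝓝[≠] (1 / 2) with hl
  set L : ℝ → ℕ := fun p => charLength ε (projIcc (0 : ℝ) 1 zero_le_one p) with hL
  -- `log |p - 1/2| → -∞`
  have habs : Tendsto (fun p : ℝ => |p - 1 / 2|) l (𝓝[>] 0) := by
    refine tendsto_nhdsWithin_iff.2 ⟨?_, ?_⟩
    · have h0 : Tendsto (fun p : ℝ => p - 1 / 2) l (𝓝 0) :=
        (tendsto_nhdsWithin_iff.1 tendsto_sub_half_nhdsNE).1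
      have h1 := (continuous_abs.tendsto (0 : ℝ)).comp h0
      rw [abs_zero] at h1
      exact h1
    · filter_upwards [self_mem_nhdsWithin] with p hp
      exact abs_pos.2 (sub_ne_zero.2 hp)
  have hlogabs : Tendsto (fun p : ℝ => Real.log |p - 1 / 2|) l atBot :=
    Real.tendsto_log_nhdsGT_zero.comp habs
  -- `log L = (log L / log |p - 1/2|) · log |p - 1/2| → +∞`
  have hlogL : Tendsto (fun p => Real.log (L p : ℝ)) l atTop := by
    have h := Filter.Tendsto.neg_mul_atBot (by norm_num : (-(4 / 3) : ℝ) < 0) hν hlogabs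
    refine h.congr' ?_
    filter_upwards [hlogabs.eventually_lt_atBot 0] with p hp
    rw [div_mul_cancel₀ _ hp.ne]
  -- hence `L → ∞`
  have hreal : Tendsto (fun p => (L p : ℝ)) l atTop := by
    refine (Real.tendsto_exp_atTop.comp hlogL).congr' ?_
    filter_upwards [hlogL.eventually_gt_atTop 0] with p hp
    have hL0 : (0 : ℝ) < L p := by
      rcases (Nat.cast_nonneg (L p) : (0 : ℝ) ≤ L p).eq_or_lt with h0 | h0
      · rw [← h0, Real.log_zero] at hp
        exact absurd hp (lt_irrefl 0)
      · exact h0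
    exact Real.exp_log hL0
  exact tendsto_natCast_atTop_iff.1 hreal

/-- **`log χ^f(p) / log |p - 1/2| → -43/18`** from `ν = 4/3` in the form
`log L_ε(p) / log |p - 1/2| → -4/3` and the power bounds
`c_η L_ε^{43/24 - η} ≤ χ^f ≤ C_η L_ε^{43/24 + η}` (every `η > 0`, for `p ≠ 1/2` near `1/2` with
`L_ε(p)` large) — the kernel-free form of `tendsto_log_triMeanClusterSize_div_log_of_powerBounds`,
same proof: the bounds give `log χ^f(p) / log L_ε(p) → 43/24` and the two limits multiply. [cite: Nolin2008, §7.5, display after Prop. 43 (arXiv 0711.4948 numbering)] [cite: SmirnovWernerMRL2001, §2, Thm. 1 (ii) (arXiv:math/0109120)] -/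
theorem tendsto_log_triMeanClusterSize_div_log_of_charLengthExponent {ε : ℝ}
    (hν : Tendsto (fun p : ℝ => Real.log (charLength ε (projIcc (0 : ℝ) 1 zero_le_one p) : ℝ) /
      Real.log |p - 1 / 2|) (𝓝[≠] (1 / 2)) (𝓝 (-(4 / 3))))
    (hlow : ∀ η : ℝ, 0 < η → ∃ δ > (0 : ℝ), ∃ L₀ : ℕ, ∃ c > (0 : ℝ), ∀ p : unitInterval,
      (p : ℝ) ≠ 1 / 2 → |(p : ℝ) - 1 / 2| < δ → L₀ ≤ charLength ε p →
        ENNReal.ofReal (c * (charLength ε p : ℝ) ^ ((43 : ℝ) / 24 - η)) ≤ triMeanClusterSize p)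
    (hup : ∀ η : ℝ, 0 < η → ∃ δ > (0 : ℝ), ∃ L₀ : ℕ, ∃ C : ℝ, ∀ p : unitInterval,
      (p : ℝ) ≠ 1 / 2 → |(p : ℝ) - 1 / 2| < δ → L₀ ≤ charLength ε p →
        triMeanClusterSize p ≤ ENNReal.ofReal (C * (charLength ε p : ℝ) ^ ((43 : ℝ) / 24 + η))) :
    Tendsto (fun p : ℝ => Real.log (triMeanClusterSizeReal p).toReal / Real.log |p - 1 / 2|)
      (𝓝[≠] (1 / 2)) (𝓝 (-(43 / 18))) := by
  have hLnat' := tendsto_charLength_atTop_of_charLengthExponent hν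
  set l : Filter ℝ := 𝓝[≠] (1 / 2) with hl
  set L : ℝ → ℕ := fun p => charLength ε (projIcc (0 : ℝ) 1 zero_le_one p) with hL
  set χR : ℝ → ℝ := fun p => (triMeanClusterSizeReal p).toReal with hχR
  have hLnat : Tendsto L l atTop := hLnat'
  have hLreal : Tendsto (fun p => (L p : ℝ)) l atTop := tendsto_natCast_atTop_iff.2 hLnat
  have hlogL : Tendsto (fun p => Real.log (L p : ℝ)) l atTop := Real.tendsto_log_atTop.comp hLreal
  have hχdef : ∀ p : ℝ, triMeanClusterSizeReal p = triMeanClusterSize (projIcc (0 : ℝ) 1 zero_le_one p) :=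
    fun _ => rfl
  -- transfer of the two bounds to the filter `l`
  have hlow' : ∀ η : ℝ, 0 < η → ∃ c > (0 : ℝ), ∀ᶠ p in l,
      ENNReal.ofReal (c * (L p : ℝ) ^ ((43 : ℝ) / 24 - η)) ≤ triMeanClusterSizeReal p := by
    intro η hη
    obtain ⟨δ, hδ, L₀, c, hc, h⟩ := hlow η hη
    refine ⟨c, hc, ?_⟩
    filter_upwards [eventually_nhdsNE_half hδ, hLnat.eventually_ge_atTop L₀] with p ⟨_, hne, hlt, hval⟩ hL₀
    rw [hχdef]
    exact h _ (by rwa [hval]) (by rwa [hval]) hL₀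
  have hup' : ∀ η : ℝ, 0 < η → ∃ C : ℝ, ∀ᶠ p in l,
      triMeanClusterSizeReal p ≤ ENNReal.ofReal (C * (L p : ℝ) ^ ((43 : ℝ) / 24 + η)) := by
    intro η hη
    obtain ⟨δ, hδ, L₀, C, h⟩ := hup η hη
    refine ⟨C, ?_⟩
    filter_upwards [eventually_nhdsNE_half hδ, hLnat.eventually_ge_atTop L₀] with p ⟨_, hne, hlt, hval⟩ hL₀
    rw [hχdef]
    exact h _ (by rwa [hval]) (by rwa [hval]) hL₀
  -- finiteness and positivity of `χ^f` along `l`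
  have hfin : ∀ᶠ p in l, triMeanClusterSizeReal p ≠ ∞ := by
    obtain ⟨C, hC⟩ := hup' 1 one_pos
    filter_upwards [hC] with p hp
    exact ne_top_of_le_ne_top ENNReal.ofReal_ne_top hp
  have hL1 : ∀ᶠ p in l, (1 : ℝ) < L p := hLreal.eventually_gt_atTop 1
  -- lower bound on `log χ^f / log L`
  have hg_low : ∀ b : ℝ, b < 43 / 24 → ∀ᶠ p in l, b < Real.log (χR p) / Real.log (L p : ℝ) := by
    intro b hb
    set η : ℝ := (43 / 24 - b) / 2 with hη
    have hη0 : 0 < η := by rw [hη]; linarith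
    obtain ⟨c, hc, hcev⟩ := hlow' η hη0
    have hlogc : ∀ᶠ p in l, -η < Real.log c / Real.log (L p : ℝ) :=
      (tendsto_const_nhds.div_atTop hlogL).eventually (lt_mem_nhds (by linarith))
    filter_upwards [hcev, hfin, hL1, hlogc] with p hcle hfinp hL1p hlogcp
    have hL0 : (0 : ℝ) < L p := by linarith
    have hlogL0 : 0 < Real.log (L p : ℝ) := Real.log_pos hL1p
    have hX : 0 < c * (L p : ℝ) ^ ((43 : ℝ) / 24 - η) := by positivity
    have hχle : c * (L p : ℝ) ^ ((43 : ℝ) / 24 - η) ≤ χR p :=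
      (ENNReal.ofReal_le_iff_le_toReal hfinp).1 hcle
    have hχpos : 0 < χR p := hX.trans_le hχle
    have hlog : Real.log c + ((43 : ℝ) / 24 - η) * Real.log (L p : ℝ) ≤ Real.log (χR p) := by
      rw [← Real.log_rpow hL0, ← Real.log_mul hc.ne' (Real.rpow_pos_of_pos hL0 _).ne']
      exact Real.log_le_log hX hχle
    rw [lt_div_iff₀ hlogL0]
    have h1 : -η * Real.log (L p : ℝ) < Real.log c := by
      rwa [lt_div_iff₀ hlogL0] at hlogcp
    have h2 : b = (43 : ℝ) / 24 - η + -η := by rw [hη]; ring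
    rw [h2]
    nlinarith [h1, hlog, hlogL0]
  -- upper bound on `log χ^f / log L`
  have hg_up : ∀ b : ℝ, 43 / 24 < b → ∀ᶠ p in l, Real.log (χR p) / Real.log (L p : ℝ) < b := by
    intro b hb
    set η : ℝ := (b - 43 / 24) / 2 with hη
    have hη0 : 0 < η := by rw [hη]; linarith
    obtain ⟨C, hCev⟩ := hup' η hη0
    obtain ⟨c, hc, hcev⟩ := hlow' 1 one_pos
    have hlogC : ∀ᶠ p in l, Real.log C / Real.log (L p : ℝ) < η :=
      (tendsto_const_nhds.div_atTop hlogL).eventually (gt_mem_nhds hη0)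
    filter_upwards [hCev, hcev, hfin, hL1, hlogC] with p hCle hcle hfinp hL1p hlogCp
    have hL0 : (0 : ℝ) < L p := by linarith
    have hlogL0 : 0 < Real.log (L p : ℝ) := Real.log_pos hL1p
    -- positivity of `χ^f` from the lower bound at `η = 1`
    have hχpos : 0 < χR p := by
      have hX : 0 < c * (L p : ℝ) ^ ((43 : ℝ) / 24 - 1) := by positivity
      exact hX.trans_le ((ENNReal.ofReal_le_iff_le_toReal hfinp).1 hcle)
    -- the upper constant is positive and the bound transfers to `toReal`
    set X : ℝ := (L p : ℝ) ^ ((43 : ℝ) / 24 + η) with hXdef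
    have hXpos : 0 < X := Real.rpow_pos_of_pos hL0 _
    have hχle : χR p ≤ max (C * X) 0 := by
      have := ENNReal.toReal_mono ENNReal.ofReal_ne_top hCle
      rwa [ENNReal.toReal_ofReal'] at this
    have hCX : 0 < C * X := by
      by_contra hCX
      push Not at hCX
      rw [max_eq_right hCX] at hχle
      exact absurd hχle (not_le.2 hχpos)
    have hCpos : 0 < C := pos_of_mul_pos_left hCX hXpos.le
    rw [max_eq_left hCX.le] at hχle
    have hlog : Real.log (χR p) ≤ Real.log C + ((43 : ℝ) / 24 + η) * Real.log (L p : ℝ) := by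
      rw [← Real.log_rpow hL0, ← Real.log_mul hCpos.ne' hXpos.ne']
      exact Real.log_le_log hχpos hχle
    rw [div_lt_iff₀ hlogL0]
    have h1 : Real.log C < η * Real.log (L p : ℝ) := by
      rwa [div_lt_iff₀ hlogL0] at hlogCp
    have h2 : b = (43 : ℝ) / 24 + η + η := by rw [hη]; ring
    rw [h2]
    nlinarith [h1, hlog, hlogL0]
  have hg : Tendsto (fun p => Real.log (χR p) / Real.log (L p : ℝ)) l (𝓝 (43 / 24)) :=
    tendsto_order.2 ⟨hg_low, hg_up⟩
  -- conclude: `log χ / log |p - 1/2| = (log χ / log L) · (log L / log |p - 1/2|)`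
  have h := hg.mul hν
  have hlim : (43 / 24 : ℝ) * -(4 / 3) = -(43 / 18) := by norm_num
  rw [hlim] at h
  refine h.congr' ?_
  filter_upwards [hL1] with p hL1p
  have hlogL0 : Real.log (L p : ℝ) ≠ 0 := (Real.log_pos hL1p).ne'
  rw [div_mul_div_cancel₀ hlogL0]

/-- **Assembly of crit-perc.S16 (`γ = 43/18`), kernel-free power-bound form**: `ν = 4/3` for
`L_ε` (as the limit `log L_ε(p) / log |p - 1/2| → -4/3`) and the bounds
`c_η L_ε^{43/24 - η} ≤ χ^f ≤ C_η L_ε^{43/24 + η}` (every `η > 0`, near `p = 1/2`, `L_ε` large)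
imply `triMeanClusterSize_exponent` (primed: the unprimed theorem of
`MeanClusterSizeExponentAssembly.lean` takes the four-arm exponent and Kesten's relation instead of
`ν`). [cite: SmirnovWernerMRL2001, §2, Thm. 1 (ii) (arXiv:math/0109120)] [cite: Nolin2008, §7.5, Prop. 43 and the display after it (arXiv 0711.4948 numbering)] -/
theorem triMeanClusterSize_exponent_of_powerBounds' {ε : ℝ}
    (hν : Tendsto (fun p : ℝ => Real.log (charLength ε (projIcc (0 : ℝ) 1 zero_le_one p) : ℝ) /
      Real.log |p - 1 / 2|) (𝓝[≠] (1 / 2)) (𝓝 (-(4 / 3))))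
    (hlow : ∀ η : ℝ, 0 < η → ∃ δ > (0 : ℝ), ∃ L₀ : ℕ, ∃ c > (0 : ℝ), ∀ p : unitInterval,
      (p : ℝ) ≠ 1 / 2 → |(p : ℝ) - 1 / 2| < δ → L₀ ≤ charLength ε p →
        ENNReal.ofReal (c * (charLength ε p : ℝ) ^ ((43 : ℝ) / 24 - η)) ≤ triMeanClusterSize p)
    (hup : ∀ η : ℝ, 0 < η → ∃ δ > (0 : ℝ), ∃ L₀ : ℕ, ∃ C : ℝ, ∀ p : unitInterval,
      (p : ℝ) ≠ 1 / 2 → |(p : ℝ) - 1 / 2| < δ → L₀ ≤ charLength ε p →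
        triMeanClusterSize p ≤ ENNReal.ofReal (C * (charLength ε p : ℝ) ^ ((43 : ℝ) / 24 + η))) :
    triMeanClusterSize_exponent := by
  have h := tendsto_log_triMeanClusterSize_div_log_of_charLengthExponent hν hlow hup
  rw [show (-(43 / 18) : ℝ) = -43 / 18 by norm_num] at h
  constructor
  · have h' := h.mono_left (nhdsWithin_mono (1 / 2 : ℝ) (fun p (hp : 1 / 2 < p) => ne_of_gt hp))
    refine h'.congr' (Eventually.of_forall fun p => ?_)
    simp only [Real.log_abs]
  · have h' := h.mono_left (nhdsWithin_mono (1 / 2 : ℝ) (fun p (hp : p < 1 / 2) => ne_of_lt hp))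
    refine h'.congr' (Eventually.of_forall fun p => ?_)
    simp only
    rw [← Real.log_abs (1 / 2 - p), abs_sub_comm]

/-- **`γ = 43/18` from `oneArm_exponent`, `ν = 4/3` at `ε`, one-arm stability at `ε` and the
radius decay beyond `L_ε`** (Nolin 2008, §7.5, Prop. 43 and the display after it:
`χ(p) ≍ L(p)² π₁(L(p))² ≈ L(p)^{43/24}`, `L(p) ≈ |p - 1/2|^{-4/3}`): the kernel-free assembly
`triMeanClusterSize_exponent_of_powerBounds'` fed by the tree's lower bound
(`triMeanClusterSize_powerLowerBound_of_sq_at`, `triMeanClusterSize_ge_sq_at`: Lemma 42, lower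
half, from Thm. 27 (`j = 1`) at `ε`) and upper bound (`triMeanClusterSize_le_rpow_at`: Lemma 42,
upper half, from `oneArm_exponent`, Thm. 27 at `ε` and `Nolin2008_radius_decay_at ε`). [cite: Nolin2008, §7.5, Lemma 42 and Prop. 43 (arXiv 0711.4948 numbering); §6.1 Thm. 27, j = 1 (EJP numbering)] [cite: SmirnovWernerMRL2001, §2, Thm. 1 (ii) (arXiv:math/0109120)] -/
theorem triMeanClusterSize_exponent_of_charLengthExponent_at {ε : ℝ} (hε : 0 < ε)
    (h₁ : oneArm_exponent)
    (hν : Tendsto (fun p : ℝ => Real.log (charLength ε (projIcc (0 : ℝ) 1 zero_le_one p) : ℝ) /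
      Real.log |p - 1 / 2|) (𝓝[≠] (1 / 2)) (𝓝 (-(4 / 3))))
    (h27 : ∃ δ > (0 : ℝ), ∃ c > (0 : ℝ), ∃ C : ℝ,
      ∀ p : unitInterval, (p : ℝ) ≠ 1 / 2 → |(p : ℝ) - 1 / 2| < δ →
        ∀ N ≤ charLength ε p,
          c * critOneArmProb N ≤ (triSitePercolation p).real (triOneArm N) ∧
            (triSitePercolation p).real (triOneArm N) ≤ C * critOneArmProb N)
    (hdec : Nolin2008_radius_decay_at ε) : triMeanClusterSize_exponent :=
  triMeanClusterSize_exponent_of_powerBounds' hν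
    (triMeanClusterSize_powerLowerBound_of_sq_at h₁ (triMeanClusterSize_ge_sq_at hε h27))
    (fun _ hη => triMeanClusterSize_le_rpow_at h₁ h27 hdec hη)

/-- **`γ = 43/18` from `oneArm_exponent`, `ν = 4/3` for `L_ε` at all small `ε`, and Nolin's
Thm. 27 (`j = 1`)** — the kernel-free list of inputs of `triMeanClusterSize_exponent`: IF
`π₁(n) = n^{-5/48 + o(1)}` (LSW 2002, Thm. 1.1), IF for every small `ε` the characteristic length
obeys `log L_ε(p) / log |p - 1/2| → -4/3` as `p → 1/2` (Nolin 2008, §7.3, display after Prop. 34: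
`L(p) ≈ |p - 1/2|^{-4/3}`, from the four-arm exponent and Kesten's relation — for whichever four-arm
kernel the relation is proved, `tendsto_log_charLength_div_log_of_kernel_at`), and IF one arm is
stable below `L_ε(p)` (`Nolin2008_thm27_oneArm`), THEN `χ^f(p) = |p - 1/2|^{-43/18 + o(1)}`; the
radius decay beyond `L_ε` is the tree's theorem `Nolin2008_lemma39_at_holds_small`, used at
`ε = min (ε₀, ε₁ / 2, 1 / 4)`. [cite: Nolin2008, §7.5, Prop. 43 and the display after it (arXiv 0711.4948 numbering); §7.3 display after Prop. 34, §7.4 Lemma 39, §6.1 Thm. 27 (EJP numbering)] [cite: SmirnovWernerMRL2001, §2, Thm. 1 (ii) (arXiv:math/0109120)] [cite: KestenScalingCMP1987, Cor. 1 (γ = 43/18 given the arm exponents)] -/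
theorem triMeanClusterSize_exponent_of_charLengthExponent (h₁ : oneArm_exponent)
    (hν : ∃ ε₁ > (0 : ℝ), ∀ ⦃ε : ℝ⦄, 0 < ε → ε < ε₁ →
      Tendsto (fun p : ℝ => Real.log (charLength ε (projIcc (0 : ℝ) 1 zero_le_one p) : ℝ) /
        Real.log |p - 1 / 2|) (𝓝[≠] (1 / 2)) (𝓝 (-(4 / 3))))
    (h27 : Nolin2008_thm27_oneArm) : triMeanClusterSize_exponent := by
  obtain ⟨ε₀, hε₀, h37⟩ := Nolin2008_lemma39_at_holds_small
  obtain ⟨ε₁, hε₁, hν⟩ := hν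
  set ε : ℝ := min ε₀ (min (ε₁ / 2) (1 / 4)) with hεdef
  have hε : 0 < ε := lt_min hε₀ (lt_min (half_pos hε₁) (by norm_num))
  have hε0 : ε ≤ ε₀ := min_le_left _ _
  have hε1 : ε < ε₁ :=
    lt_of_le_of_lt ((min_le_right _ _).trans (min_le_left _ _)) (half_lt_self hε₁)
  have hε' : ε < 1 / 2 :=
    lt_of_le_of_lt ((min_le_right _ _).trans (min_le_right _ _)) (by norm_num)
  exact triMeanClusterSize_exponent_of_charLengthExponent_at hε h₁ (hν hε hε1) (h27 hε hε')
    (Nolin2008_radius_decay_at_of_lemma39_at' (h37 ε hε0))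

/-! ### `L_ε(p) → ∞` and `ν = 4/3` for any four-arm kernel -/

section Kernel

variable {Q : ℕ → ℕ → ℝ}

/-- **`L_ε(p) → ∞` as `p → 1/2` from the lower Kesten bound, any kernel** (Nolin 2008, §3.1,
Proposition "`L_{ε₀}(p) → +∞`"; here, as in `tendsto_charLength_atTop_at`, from
`c ≤ |p - 1/2| L_ε(p)² Q(r₀, L_ε(p))` and `Q ≤ 1`: `L² ≥ c / |p - 1/2|`). [cite: Nolin2008, §3.1 (Proposition: L → ∞) and §7.3 Prop. 34 (EJP numbering)] -/
theorem tendsto_charLength_atTop_of_kernel_at (hQ1 : ∀ r R, Q r R ≤ 1) {ε : ℝ}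
    (hK : ∃ r₁ : ℕ, ∀ r₀ ≥ r₁, ∃ δ > (0 : ℝ), ∃ c > (0 : ℝ), ∃ C : ℝ,
      ∀ p : unitInterval, (p : ℝ) ≠ 1 / 2 → |(p : ℝ) - 1 / 2| < δ →
        c ≤ |(p : ℝ) - 1 / 2| * (charLength ε p : ℝ) ^ 2 * Q r₀ (charLength ε p) ∧
          |(p : ℝ) - 1 / 2| * (charLength ε p : ℝ) ^ 2 * Q r₀ (charLength ε p) ≤ C) :
    Tendsto (fun p : ℝ => charLength ε (projIcc (0 : ℝ) 1 zero_le_one p)) (𝓝[≠] (1 / 2)) atTop := by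
  obtain ⟨r₁, hr₁⟩ := hK
  obtain ⟨δ, hδ, c, hc, C, hb⟩ := hr₁ r₁ le_rfl
  set L : ℝ → ℕ := fun p => charLength ε (projIcc (0 : ℝ) 1 zero_le_one p) with hL
  -- `c / |p - 1/2| → +∞`
  have hinv : Tendsto (fun p : ℝ => c * |p - 1 / 2|⁻¹) (𝓝[≠] (1 / 2)) atTop := by
    refine Tendsto.const_mul_atTop hc ?_
    have habs : Tendsto (fun p : ℝ => |p - 1 / 2|) (𝓝[≠] (1 / 2)) (𝓝[>] 0) := by
      refine tendsto_nhdsWithin_iff.2 ⟨?_, ?_⟩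
      · have h0 : Tendsto (fun p : ℝ => p - 1 / 2) (𝓝[≠] (1 / 2)) (𝓝 0) :=
          (tendsto_nhdsWithin_iff.1 tendsto_sub_half_nhdsNE).1
        have h1 := (continuous_abs.tendsto (0 : ℝ)).comp h0
        rw [abs_zero] at h1
        exact h1
      · filter_upwards [self_mem_nhdsWithin] with p hp
        exact abs_pos.2 (sub_ne_zero.2 hp)
    exact tendsto_inv_nhdsGT_zero.comp habs
  -- hence `L² → ∞`
  have hsq : Tendsto (fun p : ℝ => (L p : ℝ) ^ 2) (𝓝[≠] (1 / 2)) atTop := by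
    refine tendsto_atTop_mono' _ ?_ hinv
    filter_upwards [eventually_nhdsNE_half hδ] with p ⟨_, hne, hlt, hval⟩
    have hb' := (hb (projIcc (0 : ℝ) 1 zero_le_one p) (by rwa [hval]) (by rwa [hval])).1
    rw [hval] at hb'
    have habs : 0 < |p - 1 / 2| := abs_pos.2 (sub_ne_zero.2 hne)
    have hπ : Q r₁ (L p) ≤ 1 := hQ1 _ _
    have hL0 : 0 ≤ |p - 1 / 2| * (L p : ℝ) ^ 2 := by positivity
    have : c ≤ |p - 1 / 2| * (L p : ℝ) ^ 2 :=
      hb'.trans (by simpa using mul_le_mul_of_nonneg_left hπ hL0)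
    rw [← div_eq_mul_inv, div_le_iff₀ habs]
    linarith [this]
  -- and `L → ∞`
  have hreal : Tendsto (fun p : ℝ => (L p : ℝ)) (𝓝[≠] (1 / 2)) atTop := by
    refine tendsto_atTop.2 fun b => ?_
    filter_upwards [hsq.eventually_ge_atTop (max b 0 ^ 2)] with p hp
    have h0 : (0 : ℝ) ≤ (L p : ℝ) := Nat.cast_nonneg _
    exact (le_max_left b 0).trans ((pow_le_pow_iff_left₀ (le_max_right b 0) h0 two_ne_zero).1 hp)
  exact tendsto_natCast_atTop_iff.1 hreal

/-- **`ν = 4/3` for the characteristic length, two-sided, any four-arm kernel** (Nolin 2008,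
§7.3, display after Prop. 34, and §7.2, Theorem "Critical exponents": `L(p) ≈ |p - 1/2|^{-4/3}`;
Werner 2009, Cor. 6.4; Kesten 1987, Cor. 1). Let `Q : ℕ → ℕ → ℝ` take values in `[0, 1]`, have
critical exponent `5/4` — `log Q(r₀, N) / log N → -5/4` for every large `r₀` (Smirnov–Werner
2001, Thm. 4, `j = 4`, for the four-arm event of one's choice: order-free `π₄`, or the alternating
`π̂^alt_{1/2}`) — and satisfy the two-sided Kesten bounds `c ≤ |p - 1/2| L_ε(p)² Q(r₀, L_ε(p)) ≤ C`
at `ε` for `p ≠ 1/2` near `1/2` (Nolin's Prop. 34 / Kesten's (4.5) with Thm. 1, for that event).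
Then `log L_ε(p) / log |p - 1/2| → -4/3` as `p → 1/2`, `p ≠ 1/2`. Proof as printed and as in
`tendsto_log_charLength_div_log_at` (the case `Q = critFourArmProb`): `log |p - 1/2| + 2 log L +
log Q(r₀, L)` is bounded, `log Q(r₀, L) / log L → -5/4`, hence `log |p - 1/2| / log L → -3/4`. [cite: Nolin2008, §7.3 (display after Prop. 34) and §7.2 (Theorem "Critical exponents") (EJP numbering)] [cite: WernerPCMI2009, Lecture 6, Cor. 6.4] [cite: KestenScalingCMP1987, Cor. 1 and (4.5)] -/
theorem tendsto_log_charLength_div_log_of_kernel_at (hQ0 : ∀ r R, 0 ≤ Q r R)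
    (hQ1 : ∀ r R, Q r R ≤ 1)
    (hQexp : ∃ r₁ : ℕ, ∀ r₀ ≥ r₁,
      Tendsto (fun N : ℕ => Real.log (Q r₀ N) / Real.log N) atTop (𝓝 (-(5 / 4))))
    {ε : ℝ}
    (hK : ∃ r₁ : ℕ, ∀ r₀ ≥ r₁, ∃ δ > (0 : ℝ), ∃ c > (0 : ℝ), ∃ C : ℝ,
      ∀ p : unitInterval, (p : ℝ) ≠ 1 / 2 → |(p : ℝ) - 1 / 2| < δ →
        c ≤ |(p : ℝ) - 1 / 2| * (charLength ε p : ℝ) ^ 2 * Q r₀ (charLength ε p) ∧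
          |(p : ℝ) - 1 / 2| * (charLength ε p : ℝ) ^ 2 * Q r₀ (charLength ε p) ≤ C) :
    Tendsto (fun p : ℝ => Real.log (charLength ε (projIcc (0 : ℝ) 1 zero_le_one p)) /
      Real.log |p - 1 / 2|) (𝓝[≠] (1 / 2)) (𝓝 (-(4 / 3))) := by
  obtain ⟨r₁, hr₁⟩ := hQexp
  obtain ⟨r₁', hr₁'⟩ := hK
  set r₀ : ℕ := max r₁ r₁' with hr₀
  have hA : Tendsto (fun N : ℕ => Real.log (Q r₀ N) / Real.log N) atTop (𝓝 (-(5 / 4))) :=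
    hr₁ r₀ (le_max_left _ _)
  obtain ⟨δ, hδ, c, hc, C, hb⟩ := hr₁' r₀ (le_max_right _ _)
  set l : Filter ℝ := 𝓝[≠] (1 / 2) with hl
  set L : ℝ → ℕ := fun p => charLength ε (projIcc (0 : ℝ) 1 zero_le_one p) with hL
  have hLnat : Tendsto L l atTop := tendsto_charLength_atTop_of_kernel_at hQ1 ⟨r₁', hr₁'⟩
  have hLreal : Tendsto (fun p => (L p : ℝ)) l atTop := tendsto_natCast_atTop_iff.2 hLnat
  have hlogL : Tendsto (fun p => Real.log (L p : ℝ)) l atTop := Real.tendsto_log_atTop.comp hLreal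
  -- the exponent of `Q` along `L(p)`
  have hA' : Tendsto (fun p => Real.log (Q r₀ (L p)) / Real.log (L p : ℝ)) l (𝓝 (-(5 / 4))) :=
    hA.comp hLnat
  -- eventual positivity / bounds
  have hpos4 : ∀ᶠ p in l, 0 < Q r₀ (L p) :=
    hLnat.eventually (hasDecayExponent_eventually_pos hA (by norm_num) (fun _ => hQ0 _ _))
  have hev : ∀ᶠ p in l, 1 < (L p : ℝ) ∧ 0 < Q r₀ (L p) ∧ 0 < |p - 1 / 2| ∧
      c ≤ |p - 1 / 2| * (L p : ℝ) ^ 2 * Q r₀ (L p) ∧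
      |p - 1 / 2| * (L p : ℝ) ^ 2 * Q r₀ (L p) ≤ C := by
    filter_upwards [hLreal.eventually_gt_atTop 1, hpos4, eventually_nhdsNE_half hδ] with p h1 h2
      ⟨_, hne, hlt, hval⟩
    have hb' := hb (projIcc (0 : ℝ) 1 zero_le_one p) (by rwa [hval]) (by rwa [hval])
    rw [hval] at hb'
    exact ⟨h1, h2, abs_pos.2 (sub_ne_zero.2 hne), hb'.1, hb'.2⟩
  -- `B(p) := log |p - 1/2| + 2 log L + log Q(r₀, L)` is bounded, hence `B / log L → 0`
  have hB : Tendsto (fun p => (Real.log |p - 1 / 2| + 2 * Real.log (L p : ℝ) +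
      Real.log (Q r₀ (L p))) / Real.log (L p : ℝ)) l (𝓝 0) := by
    have hlow : Tendsto (fun p => Real.log c / Real.log (L p : ℝ)) l (𝓝 0) :=
      tendsto_const_nhds.div_atTop hlogL
    have hup : Tendsto (fun p => Real.log C / Real.log (L p : ℝ)) l (𝓝 0) :=
      tendsto_const_nhds.div_atTop hlogL
    refine tendsto_of_tendsto_of_tendsto_of_le_of_le' hlow hup ?_ ?_
    · filter_upwards [hev] with p ⟨hL1, hπ, habs, hcle, _⟩
      have hlogL0 : 0 < Real.log (L p : ℝ) := Real.log_pos hL1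
      have hL0 : (0 : ℝ) < (L p : ℝ) := by linarith
      rw [div_le_div_iff_of_pos_right hlogL0]
      have : Real.log c ≤ Real.log (|p - 1 / 2| * (L p : ℝ) ^ 2 * Q r₀ (L p)) :=
        Real.log_le_log hc hcle
      rwa [Real.log_mul (by positivity) hπ.ne', Real.log_mul habs.ne' (by positivity),
        Real.log_pow, Nat.cast_ofNat] at this
    · filter_upwards [hev] with p ⟨hL1, hπ, habs, hcle, hCle⟩
      have hlogL0 : 0 < Real.log (L p : ℝ) := Real.log_pos hL1
      have hL0 : (0 : ℝ) < (L p : ℝ) := by linarith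
      rw [div_le_div_iff_of_pos_right hlogL0]
      have hX : 0 < |p - 1 / 2| * (L p : ℝ) ^ 2 * Q r₀ (L p) := by positivity
      have : Real.log (|p - 1 / 2| * (L p : ℝ) ^ 2 * Q r₀ (L p)) ≤ Real.log C :=
        Real.log_le_log hX hCle
      rwa [Real.log_mul (by positivity) hπ.ne', Real.log_mul habs.ne' (by positivity),
        Real.log_pow, Nat.cast_ofNat] at this
  -- `log |p - 1/2| / log L → -3/4`
  have hR : Tendsto (fun p => Real.log |p - 1 / 2| / Real.log (L p : ℝ)) l (𝓝 (-(3 / 4))) := by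
    have h := (hB.sub hA').sub_const 2
    have hlim : (0 : ℝ) - -(5 / 4) - 2 = -(3 / 4) := by norm_num
    rw [hlim] at h
    refine h.congr' ?_
    filter_upwards [hev] with p ⟨hL1, _, _, _, _⟩
    have hlogL0 : Real.log (L p : ℝ) ≠ 0 := (Real.log_pos hL1).ne'
    field_simp
    ring
  -- invert
  have hinv := hR.inv₀ (by norm_num : (-(3 / 4) : ℝ) ≠ 0)
  have hlim : ((-(3 / 4) : ℝ))⁻¹ = -(4 / 3) := by norm_num
  rw [hlim] at hinv
  refine hinv.congr' (Eventually.of_forall fun p => ?_)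
  rw [inv_div]

end Kernel

/-! ### `γ` from Thm. 27 and a four-arm kernel -/

/-- **`γ = 43/18` from `oneArm_exponent`, Nolin's Thm. 27 (`j = 1`) and ANY four-arm kernel with
exponent `5/4` obeying Kesten's relation at small `ε`** (Smirnov–Werner 2001, Thm. 1 (ii), along
Kesten 1987 / Nolin 2008, §7: `χ ≍ L² π₁(L)²`, `L ≈ |p - 1/2|^{-4/3}`):
`triMeanClusterSize_exponent_of_charLengthExponent` with `ν = 4/3` from
`tendsto_log_charLength_div_log_of_kernel_at`. The order-free instance (`Q = critFourArmProb`,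
`fourArm_exponent`, `Nolin2008_prop34`) is `triMeanClusterSize_exponent_of_leaves4` (see the
`example` below); the alternating instance is `triMeanClusterSize_exponent_of_altHyps`. [cite: SmirnovWernerMRL2001, §2, Thm. 1 (ii) (arXiv:math/0109120)] [cite: KestenScalingCMP1987, Cor. 1, Thm. 1 and (4.5)] [cite: Nolin2008, §7.3 Prop. 34 and the display after it, §6.1 Thm. 27 (EJP numbering); §7.5 Prop. 43 (arXiv 0711.4948 numbering)] -/
theorem triMeanClusterSize_exponent_of_thm27_of_kernel (h₁ : oneArm_exponent)
    (h27 : Nolin2008_thm27_oneArm) {Q : ℕ → ℕ → ℝ} (hQ0 : ∀ r R, 0 ≤ Q r R)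
    (hQ1 : ∀ r R, Q r R ≤ 1)
    (hQexp : ∃ r₁ : ℕ, ∀ r₀ ≥ r₁,
      Tendsto (fun N : ℕ => Real.log (Q r₀ N) / Real.log N) atTop (𝓝 (-(5 / 4))))
    (hK : ∃ ε₁ > (0 : ℝ), ∀ ⦃ε : ℝ⦄, 0 < ε → ε < ε₁ →
      ∃ r₁ : ℕ, ∀ r₀ ≥ r₁, ∃ δ > (0 : ℝ), ∃ c > (0 : ℝ), ∃ C : ℝ,
        ∀ p : unitInterval, (p : ℝ) ≠ 1 / 2 → |(p : ℝ) - 1 / 2| < δ →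
          c ≤ |(p : ℝ) - 1 / 2| * (charLength ε p : ℝ) ^ 2 * Q r₀ (charLength ε p) ∧
            |(p : ℝ) - 1 / 2| * (charLength ε p : ℝ) ^ 2 * Q r₀ (charLength ε p) ≤ C) :
    triMeanClusterSize_exponent := by
  obtain ⟨ε₁, hε₁, hK⟩ := hK
  exact triMeanClusterSize_exponent_of_charLengthExponent h₁
    ⟨ε₁, hε₁, fun ε hε hε' => tendsto_log_charLength_div_log_of_kernel_at hQ0 hQ1 hQexp (hK hε hε')⟩
    h27

/-- Sanity check (the order-free kernel): at `Q = critFourArmProb`, with `fourArm_exponent` and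
`Nolin2008_prop34`, the kernel theorem gives back `triMeanClusterSize_exponent_of_leaves4`
(`MeanClusterSizeExponentFromFacts.lean`). -/
example (h₁ : oneArm_exponent) (h₄ : fourArm_exponent) (hK : Nolin2008_prop34)
    (h27 : Nolin2008_thm27_oneArm) : triMeanClusterSize_exponent := by
  obtain ⟨r₁, hr₁⟩ := h₄
  exact triMeanClusterSize_exponent_of_thm27_of_kernel h₁ h27 (Q := critFourArmProb)
    (fun _ _ => measureReal_nonneg) (fun _ _ => measureReal_le_one)
    ⟨r₁, fun r₀ hr₀ => hr₁ r₀ hr₀⟩ ⟨1 / 2, one_half_pos, fun ε hε hε' => hK hε hε'⟩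

/-! ### The alternating route -/

/-- **The exponent `5/4` of the critical ALTERNATING four-arm probability from `fourArm_exponent`
and the bridge** (Smirnov–Werner 2001, §4: "One can also prescribe colours of the crossings and
their order, which will change `b_j` up to a multiplicative constant"; Nolin 2008, §5.1, Prop. 20
[arXiv 0711.4948: Prop. 19]: `P_{1/2}(A_{j,σ}) ≍ P_{1/2}(A_{j,σ'})` for non-constant `σ, σ'`): if
`π₄(r₀, N) = N^{-5/4 + o(1)}` for large `r₀` and `c · π₄(n, N) ≤ π̂^alt_{1/2}(n, N)` for `n₀ ≤ n`,
`2n ≤ N` (the bridge hypothesis `hBr` of `fourArm_exponent_of_altSeparation`,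
`ArmPatternsFourArm.lean`), then `π̂^alt_{1/2}(r₀, N) = N^{-5/4 + o(1)}` for large `r₀`
(`c π₄ ≤ π̂^alt ≤ π₄`, squeeze of the log-ratios). [cite: SmirnovWernerMRL2001, §4 (p. 7 of arXiv math/0109120) and Thm. 4 (j = 4)] [cite: Nolin2008, §5.1, Prop. 20 (arXiv 0711.4948: Prop. 19)] -/
theorem altFourArm_exponent_of_bridge (h₄ : fourArm_exponent)
    (hBr : ∃ c : ℝ, 0 < c ∧ ∃ n₀ : ℕ, ∀ n N : ℕ, n₀ ≤ n → 2 * n ≤ N →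
      c * critFourArmProb n N ≤ (triSitePercolation half).real (altFourArm n N)) :
    ∃ r₁ : ℕ, ∀ r₀ ≥ r₁,
      Tendsto (fun N : ℕ => Real.log (altFourArmProbAt half r₀ N) / Real.log N) atTop
        (𝓝 (-(5 / 4))) := by
  obtain ⟨r₁, hr₁⟩ := h₄
  obtain ⟨c, hc, n₀, hbr⟩ := hBr
  refine ⟨max r₁ n₀, fun r₀ hr₀ => ?_⟩
  have hA : Tendsto (fun N : ℕ => Real.log (critFourArmProb r₀ N) / Real.log N) atTop
      (𝓝 (-(5 / 4))) := hr₁ r₀ (le_trans (le_max_left _ _) hr₀)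
  have hn₀ : n₀ ≤ r₀ := le_trans (le_max_right _ _) hr₀
  have hlog : Tendsto (fun N : ℕ => Real.log (N : ℝ)) atTop atTop :=
    Real.tendsto_log_atTop.comp tendsto_natCast_atTop_atTop
  have hpos : ∀ᶠ N : ℕ in atTop, 0 < critFourArmProb r₀ N :=
    hasDecayExponent_eventually_pos hA (by norm_num) (fun _ => measureReal_nonneg)
  -- lower envelope: `log (c π₄) / log N → -5/4`
  have hlow : Tendsto (fun N : ℕ => (Real.log c + Real.log (critFourArmProb r₀ N)) / Real.log N)
      atTop (𝓝 (-(5 / 4))) := by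
    have h0 : Tendsto (fun N : ℕ => Real.log c / Real.log N) atTop (𝓝 0) :=
      tendsto_const_nhds.div_atTop hlog
    have h := h0.add hA
    rw [zero_add] at h
    refine h.congr' (Eventually.of_forall fun N => ?_)
    exact (add_div _ _ _).symm
  refine tendsto_of_tendsto_of_tendsto_of_le_of_le' hlow hA ?_ ?_
  · filter_upwards [hpos, eventually_ge_atTop (max 2 (2 * r₀))] with N hπ hN
    have hN1 : (1 : ℝ) < N := by exact_mod_cast (show 1 < N by omega)
    have hlogN : 0 < Real.log N := Real.log_pos hN1
    have h2 : 2 * r₀ ≤ N := le_trans (le_max_right _ _) hN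
    have hle : c * critFourArmProb r₀ N ≤ altFourArmProbAt half r₀ N := hbr r₀ N hn₀ h2
    rw [div_le_div_iff_of_pos_right hlogN, ← Real.log_mul hc.ne' hπ.ne']
    exact Real.log_le_log (by positivity) hle
  · filter_upwards [hpos, eventually_ge_atTop (max 2 (2 * r₀))] with N hπ hN
    have hN1 : (1 : ℝ) < N := by exact_mod_cast (show 1 < N by omega)
    have hlogN : 0 < Real.log N := Real.log_pos hN1
    have h2 : 2 * r₀ ≤ N := le_trans (le_max_right _ _) hN
    have hle : c * critFourArmProb r₀ N ≤ altFourArmProbAt half r₀ N := hbr r₀ N hn₀ h2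
    have haltpos : 0 < altFourArmProbAt half r₀ N := lt_of_lt_of_le (by positivity) hle
    rw [div_le_div_iff_of_pos_right hlogN]
    exact Real.log_le_log haltpos
      ((altFourArmProbAt_le_fourArmProbAt half r₀ N).trans_eq (fourArmProbAt_half r₀ N))

/-- **`γ = 43/18`, the ALTERNATING route** (Smirnov–Werner 2001, Thm. 1 (ii), along Kesten 1987
with the alternating four-arm event (1.12), Nolin 2008, §7 for `σ = BWBW`, and Werner 2009,
Lecture 6 with `π̂_p` the alternating four-arm probability). `triMeanClusterSize_exponent` follows
from

* `oneArm_exponent` (LSW 2002, Thm. 1.1);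
* the exponent `5/4` of the critical alternating kernel, `log π̂^alt_{1/2}(r₀, N) / log N → -5/4`
  for all large `r₀` (Smirnov–Werner 2001, Thm. 4, `j = 4`, for the alternating arrangement;
  `altFourArm_exponent_of_bridge` from `fourArm_exponent` and the bridge);
* the three alternating hypotheses of `Nolin2008_thm27_oneArm_of_altHyps`
  (`NearCriticalOneArmFromAltFacts.lean`) — quasi-multiplicativity of `π̂^alt = altFourArmProbAt`
  below `L(p)` (Werner's Cor. 6.2; Nolin's Prop. 17, `σ = BWBW`), the a priori bound
  `c (m/n)^{2-β} ≤ π̂^alt_t(m, n)` (Werner §3, third estimate) and the interior pivotal lower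
  bound `c π̂^alt_t(r₀, N) ≤ P_t(v pivotal for LR(2N, N))` (Werner, proof of Lemma 6.2) — which
  give the one-arm stability `Nolin2008_thm27_oneArm`;
* the two-sided Kesten bounds with the critical alternating kernel at every small `ε`:
  `c ≤ |p - 1/2| L_ε(p)² π̂^alt_{1/2}(r₀, L_ε(p)) ≤ C` for `p ≠ 1/2` near `1/2`, all large `r₀`
  (the two halves of Nolin's Prop. 34 [arXiv Prop. 32] for `σ = BWBW`; Werner's display after
  Lemma 6.3; Kesten's (4.5) with Thm. 1).

No separation statement for the adjacent colour arrangement and no colour switching enter this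
route; `triMeanClusterSize_exponent_of_thm27_of_kernel` at `Q = π̂^alt_{1/2}`. [cite: SmirnovWernerMRL2001, §2, Thm. 1 (ii) and §4, Thm. 4 (j = 4) (arXiv:math/0109120)] [cite: KestenScalingCMP1987, (1.12), Thm. 1, Cor. 1, (4.5)] [cite: Nolin2008, §7.3 Prop. 34, §6.1 Thm. 27, §4.5 Prop. 17 (EJP numbering; arXiv 0711.4948: Prop. 32, Thm. 26, Prop. 16); §7.5 Prop. 43 (arXiv numbering)] [cite: WernerPCMI2009, Lecture 6, §3, Cor. 6.2, Lemma 6.2, display after Lemma 6.3, §5] -/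
theorem triMeanClusterSize_exponent_of_altHyps (h₁ : oneArm_exponent)
    (h₄ : ∃ r₁ : ℕ, ∀ r₀ ≥ r₁,
      Tendsto (fun N : ℕ => Real.log (altFourArmProbAt half r₀ N) / Real.log N) atTop
        (𝓝 (-(5 / 4))))
    (hQM : ∃ ε₁ > (0 : ℝ), ∀ ⦃ε : ℝ⦄, 0 < ε → ε < ε₁ →
      ∃ r₁ : ℕ, ∃ δ > (0 : ℝ), ∃ c > (0 : ℝ),
        ∀ t : unitInterval, 1 / 2 ≤ (t : ℝ) → (t : ℝ) < 1 / 2 + δ →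
          ∀ r R S : ℕ, r₁ ≤ r → 16 * r < 4 * R → 4 * R < S →
            (1 / 2 < (t : ℝ) → S ≤ charLengthW ε t) →
              c * (altFourArmProbAt t r R * altFourArmProbAt t (4 * R) S) ≤ altFourArmProbAt t r S)
    (hLB : ∃ ε₁ > (0 : ℝ), ∀ ⦃ε : ℝ⦄, 0 < ε → ε < ε₁ →
      ∃ r₁ : ℕ, ∃ δ > (0 : ℝ), ∃ β > (0 : ℝ), ∃ c > (0 : ℝ),
        ∀ t : unitInterval, 1 / 2 ≤ (t : ℝ) → (t : ℝ) < 1 / 2 + δ →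
          ∀ m n : ℕ, r₁ ≤ m → m ≤ n → (1 / 2 < (t : ℝ) → n ≤ charLengthW ε t) →
            c * ((m : ℝ) / n) ^ (2 - β) ≤ altFourArmProbAt t m n)
    (hP : ∃ ε₁ > (0 : ℝ), ∀ ⦃ε : ℝ⦄, 0 < ε → ε < ε₁ →
      ∃ r₁ : ℕ, ∀ r₀ ≥ r₁, ∃ n₁ : ℕ, ∃ δ > (0 : ℝ), ∃ c > (0 : ℝ),
        ∀ t : unitInterval, 1 / 2 ≤ (t : ℝ) → (t : ℝ) < 1 / 2 + δ →
          ∀ N : ℕ, n₁ ≤ N → (1 / 2 < (t : ℝ) → N ≤ charLengthW ε t) →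
            ∀ v : Site 2, (N : ℤ) < 4 * v 0 → 4 * v 0 < 7 * N → (N : ℤ) < 4 * v 1 → 4 * v 1 < 3 * N →
              c * altFourArmProbAt t r₀ N ≤
                (triSitePercolation t).real {ω | IsPivotal (triLRCrossing (2 * N) N) v ω})
    (hK : ∃ ε₁ > (0 : ℝ), ∀ ⦃ε : ℝ⦄, 0 < ε → ε < ε₁ →
      ∃ r₁ : ℕ, ∀ r₀ ≥ r₁, ∃ δ > (0 : ℝ), ∃ c > (0 : ℝ), ∃ C : ℝ,
        ∀ p : unitInterval, (p : ℝ) ≠ 1 / 2 → |(p : ℝ) - 1 / 2| < δ →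
          c ≤ |(p : ℝ) - 1 / 2| * (charLength ε p : ℝ) ^ 2 *
              altFourArmProbAt half r₀ (charLength ε p) ∧
            |(p : ℝ) - 1 / 2| * (charLength ε p : ℝ) ^ 2 *
              altFourArmProbAt half r₀ (charLength ε p) ≤ C) :
    triMeanClusterSize_exponent :=
  triMeanClusterSize_exponent_of_thm27_of_kernel h₁ (Nolin2008_thm27_oneArm_of_altHyps hQM hLB hP)
    (Q := fun r R => altFourArmProbAt half r R) (fun _ _ => altFourArmProbAt_nonneg _ _ _)
    (fun _ _ => altFourArmProbAt_le_one _ _ _) h₄ hK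

/-- **`γ = 43/18`, the alternating route, with the two Kesten bounds displayed separately** — the
upper bound `|p - 1/2| L_ε(p)² π̂^alt_{1/2}(r₀, L_ε(p)) ≤ C` at every small `ε` and the lower
bound `c ≤ |p - 1/2| L_ε(p)² π̂^alt_{1/2}(r₀, L_ε(p))` at every `ε ∈ (0, 1/2)`, verbatim the
hypotheses `hKup`, `hKlow` of `Nolin2008_theta_asymp_of_altHyps` (`KestenScalingThetaFromKernel.lean`),
so that the same terms serve `β` and `γ`. [cite: SmirnovWernerMRL2001, §2, Thm. 1 (ii) (arXiv:math/0109120)] [cite: Nolin2008, §7.3 Prop. 34 (EJP numbering; arXiv 0711.4948: Prop. 32), the two halves; §7.5 Prop. 43 (arXiv numbering)] [cite: WernerPCMI2009, Lecture 6, display after Lemma 6.3] -/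
theorem triMeanClusterSize_exponent_of_altHyps' (h₁ : oneArm_exponent)
    (h₄ : ∃ r₁ : ℕ, ∀ r₀ ≥ r₁,
      Tendsto (fun N : ℕ => Real.log (altFourArmProbAt half r₀ N) / Real.log N) atTop
        (𝓝 (-(5 / 4))))
    (hQM : ∃ ε₁ > (0 : ℝ), ∀ ⦃ε : ℝ⦄, 0 < ε → ε < ε₁ →
      ∃ r₁ : ℕ, ∃ δ > (0 : ℝ), ∃ c > (0 : ℝ),
        ∀ t : unitInterval, 1 / 2 ≤ (t : ℝ) → (t : ℝ) < 1 / 2 + δ →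
          ∀ r R S : ℕ, r₁ ≤ r → 16 * r < 4 * R → 4 * R < S →
            (1 / 2 < (t : ℝ) → S ≤ charLengthW ε t) →
              c * (altFourArmProbAt t r R * altFourArmProbAt t (4 * R) S) ≤ altFourArmProbAt t r S)
    (hLB : ∃ ε₁ > (0 : ℝ), ∀ ⦃ε : ℝ⦄, 0 < ε → ε < ε₁ →
      ∃ r₁ : ℕ, ∃ δ > (0 : ℝ), ∃ β > (0 : ℝ), ∃ c > (0 : ℝ),
        ∀ t : unitInterval, 1 / 2 ≤ (t : ℝ) → (t : ℝ) < 1 / 2 + δ →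
          ∀ m n : ℕ, r₁ ≤ m → m ≤ n → (1 / 2 < (t : ℝ) → n ≤ charLengthW ε t) →
            c * ((m : ℝ) / n) ^ (2 - β) ≤ altFourArmProbAt t m n)
    (hP : ∃ ε₁ > (0 : ℝ), ∀ ⦃ε : ℝ⦄, 0 < ε → ε < ε₁ →
      ∃ r₁ : ℕ, ∀ r₀ ≥ r₁, ∃ n₁ : ℕ, ∃ δ > (0 : ℝ), ∃ c > (0 : ℝ),
        ∀ t : unitInterval, 1 / 2 ≤ (t : ℝ) → (t : ℝ) < 1 / 2 + δ →
          ∀ N : ℕ, n₁ ≤ N → (1 / 2 < (t : ℝ) → N ≤ charLengthW ε t) →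
            ∀ v : Site 2, (N : ℤ) < 4 * v 0 → 4 * v 0 < 7 * N → (N : ℤ) < 4 * v 1 → 4 * v 1 < 3 * N →
              c * altFourArmProbAt t r₀ N ≤
                (triSitePercolation t).real {ω | IsPivotal (triLRCrossing (2 * N) N) v ω})
    (hKup : ∃ ε₁ > (0 : ℝ), ∀ ⦃ε : ℝ⦄, 0 < ε → ε < ε₁ → ∃ r₁ : ℕ, ∀ r₀ ≥ r₁, ∃ δ > (0 : ℝ),
      ∃ C : ℝ, ∀ p : unitInterval, (p : ℝ) ≠ 1 / 2 → |(p : ℝ) - 1 / 2| < δ →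
        |(p : ℝ) - 1 / 2| * (charLength ε p : ℝ) ^ 2 * altFourArmProbAt half r₀ (charLength ε p) ≤ C)
    (hKlow : ∀ ⦃ε : ℝ⦄, 0 < ε → ε < 1 / 2 → ∃ r₁ : ℕ, ∀ r₀ ≥ r₁, ∃ δ > (0 : ℝ), ∃ c > (0 : ℝ),
      ∀ p : unitInterval, (p : ℝ) ≠ 1 / 2 → |(p : ℝ) - 1 / 2| < δ →
        c ≤ |(p : ℝ) - 1 / 2| * (charLength ε p : ℝ) ^ 2 *
          altFourArmProbAt half r₀ (charLength ε p)) :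
    triMeanClusterSize_exponent := by
  obtain ⟨ε₁, hε₁, hup⟩ := hKup
  refine triMeanClusterSize_exponent_of_altHyps h₁ h₄ hQM hLB hP
    ⟨min ε₁ (1 / 2), lt_min hε₁ one_half_pos, fun ε hε hε' => ?_⟩
  obtain ⟨r₁, hr₁⟩ := hup hε (lt_of_lt_of_le hε' (min_le_left _ _))
  obtain ⟨r₁', hr₁'⟩ := hKlow hε (lt_of_lt_of_le hε' (min_le_right _ _))
  refine ⟨max r₁ r₁', fun r₀ hr₀ => ?_⟩
  obtain ⟨δ, hδ, C, hC⟩ := hr₁ r₀ (le_trans (le_max_left _ _) hr₀)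
  obtain ⟨δ', hδ', c, hc, hc'⟩ := hr₁' r₀ (le_trans (le_max_right _ _) hr₀)
  refine ⟨min δ δ', lt_min hδ hδ', c, hc, C, fun p hp hpδ => ⟨?_, ?_⟩⟩
  · exact hc' p hp (lt_of_lt_of_le hpδ (min_le_right _ _))
  · exact hC p hp (lt_of_lt_of_le hpδ (min_le_left _ _))

/-- **`γ = 43/18`, the alternating route, with LSW's two scaling-limit facts for the one-arm
exponent** (`oneArm_exponent_of_scalingLimit'`, `OneArmLSWProofs.lean`: the existence of Smirnov's /
Camia–Newman's scaling limit, `h₁`, and LSW's Thm. 1.2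
`LawlerSchrammWerner2002_scalingLimitExponent`). [cite: LawlerSchrammWernerEJP2002, Thm. 1.1 and Thm. 1.2] [cite: SmirnovWernerMRL2001, §2, Thm. 1 (ii) (arXiv:math/0109120)] -/
theorem triMeanClusterSize_exponent_of_scalingLimit_of_altHyps
    (h₁ : ∃ ν : ProbabilityMeasure (TopologicalSpace.NonemptyCompacts ℂ),
      Tendsto lswLaw atTop (𝓝 ν))
    (h₂ : LawlerSchrammWerner2002_scalingLimitExponent)
    (h₄ : ∃ r₁ : ℕ, ∀ r₀ ≥ r₁,
      Tendsto (fun N : ℕ => Real.log (altFourArmProbAt half r₀ N) / Real.log N) atTop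
        (𝓝 (-(5 / 4))))
    (hQM : ∃ ε₁ > (0 : ℝ), ∀ ⦃ε : ℝ⦄, 0 < ε → ε < ε₁ →
      ∃ r₁ : ℕ, ∃ δ > (0 : ℝ), ∃ c > (0 : ℝ),
        ∀ t : unitInterval, 1 / 2 ≤ (t : ℝ) → (t : ℝ) < 1 / 2 + δ →
          ∀ r R S : ℕ, r₁ ≤ r → 16 * r < 4 * R → 4 * R < S →
            (1 / 2 < (t : ℝ) → S ≤ charLengthW ε t) →
              c * (altFourArmProbAt t r R * altFourArmProbAt t (4 * R) S) ≤ altFourArmProbAt t r S)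
    (hLB : ∃ ε₁ > (0 : ℝ), ∀ ⦃ε : ℝ⦄, 0 < ε → ε < ε₁ →
      ∃ r₁ : ℕ, ∃ δ > (0 : ℝ), ∃ β > (0 : ℝ), ∃ c > (0 : ℝ),
        ∀ t : unitInterval, 1 / 2 ≤ (t : ℝ) → (t : ℝ) < 1 / 2 + δ →
          ∀ m n : ℕ, r₁ ≤ m → m ≤ n → (1 / 2 < (t : ℝ) → n ≤ charLengthW ε t) →
            c * ((m : ℝ) / n) ^ (2 - β) ≤ altFourArmProbAt t m n)
    (hP : ∃ ε₁ > (0 : ℝ), ∀ ⦃ε : ℝ⦄, 0 < ε → ε < ε₁ →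
      ∃ r₁ : ℕ, ∀ r₀ ≥ r₁, ∃ n₁ : ℕ, ∃ δ > (0 : ℝ), ∃ c > (0 : ℝ),
        ∀ t : unitInterval, 1 / 2 ≤ (t : ℝ) → (t : ℝ) < 1 / 2 + δ →
          ∀ N : ℕ, n₁ ≤ N → (1 / 2 < (t : ℝ) → N ≤ charLengthW ε t) →
            ∀ v : Site 2, (N : ℤ) < 4 * v 0 → 4 * v 0 < 7 * N → (N : ℤ) < 4 * v 1 → 4 * v 1 < 3 * N →
              c * altFourArmProbAt t r₀ N ≤
                (triSitePercolation t).real {ω | IsPivotal (triLRCrossing (2 * N) N) v ω})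
    (hK : ∃ ε₁ > (0 : ℝ), ∀ ⦃ε : ℝ⦄, 0 < ε → ε < ε₁ →
      ∃ r₁ : ℕ, ∀ r₀ ≥ r₁, ∃ δ > (0 : ℝ), ∃ c > (0 : ℝ), ∃ C : ℝ,
        ∀ p : unitInterval, (p : ℝ) ≠ 1 / 2 → |(p : ℝ) - 1 / 2| < δ →
          c ≤ |(p : ℝ) - 1 / 2| * (charLength ε p : ℝ) ^ 2 *
              altFourArmProbAt half r₀ (charLength ε p) ∧
            |(p : ℝ) - 1 / 2| * (charLength ε p : ℝ) ^ 2 *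
              altFourArmProbAt half r₀ (charLength ε p) ≤ C) :
    triMeanClusterSize_exponent :=
  triMeanClusterSize_exponent_of_altHyps (oneArm_exponent_of_scalingLimit' h₁ h₂) h₄ hQM hLB hP hK

/-! ### The order-free route: the complete list of inputs -/

/-- **What `triMeanClusterSize_exponent_holds` needs on the order-free route, exactly** (Smirnov–
Werner 2001, Thm. 1 (ii), with every discrete step of its printed proof — "shown by Kesten in
[Kpaper] … provided that (1) `P[A_R^1] = R^{-5/48 + o(1)}` and (2) `P[A_R^2] = R^{-5/4 + o(1)}`" —
supplied by the tree except the separation theorem; mirror of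
`triTheta_exponent_of_scalingLimits_of_separation`). IF
* the clusters meeting the unit circle have a scaling limit (`h₁`, LSW 2002, §2, p. 3)
  whose law obeys LSW's Thm. 1.2 (`LawlerSchrammWerner2002_scalingLimitExponent`) — giving (1)
  `oneArm_exponent` by `oneArm_exponent_of_scalingLimit'`;
* the critical four-arm probabilities have the scaling limit `π₄(ρ r, ρ R) → L(r, R)` with
  `log L(1, n) / log n → -5/4` (SW (16) and (9)) — giving (2) `fourArm_exponent` by
  `fourArm_exponent_of_scalingLimit_of_nearCritical_separation`;
* near-critical four-arm separation below `L(p)` holds (Nolin 2008, Thm. 11, `j = 4`; Kesten 1987,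
  Lemmas 4–6) — giving Kesten's scaling relations by `triMeanClusterSize_exponent_of_separation`,
THEN `χ^f(p) = |p - 1/2|^{-43/18 + o(1)}` as `p → 1/2`. [cite: SmirnovWernerMRL2001, §2, Thm. 1 (ii) and the paragraph following Thm. 1; Thm. 4 (j = 4) (arXiv math/0109120, p. 4)] [cite: LawlerSchrammWernerEJP2002, Thm. 1.1 and Thm. 1.2] [cite: KestenScalingCMP1987, Thm. 1, Cor. 1, Lemmas 4–6] [cite: Nolin2008, §4.3 Thm. 11 (arXiv 0711.4948: Thm. 10)] -/
theorem triMeanClusterSize_exponent_of_scalingLimits_of_separation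
    (h₁ : ∃ ν : ProbabilityMeasure (TopologicalSpace.NonemptyCompacts ℂ),
      Tendsto lswLaw atTop (𝓝 ν))
    (h₂ : LawlerSchrammWerner2002_scalingLimitExponent)
    (L : ℕ → ℕ → ℝ)
    (hlim : ∀ r R : ℕ, 1 ≤ r → r < R →
      Tendsto (fun ρ : ℕ => critFourArmProb (ρ * r) (ρ * R)) atTop (𝓝 (L r R)))
    (hexp : Tendsto (fun n : ℕ => Real.log (L 1 n) / Real.log n) atTop (𝓝 (-(5 / 4))))
    (hsep : ∃ ε₁ > (0 : ℝ), ∀ ⦃ε : ℝ⦄, 0 < ε → ε < ε₁ →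
      ∃ n₀ : ℕ, ∃ δ > (0 : ℝ), ∃ c > (0 : ℝ),
        ∀ t : unitInterval, 1 / 2 ≤ (t : ℝ) → (t : ℝ) < 1 / 2 + δ →
          ∀ n N : ℕ, n₀ ≤ n → 2 * n ≤ N → (1 / 2 < (t : ℝ) → N ≤ charLengthW ε t) →
            c * fourArmProbAt t n N ≤ (triSitePercolation t).real (sepFourArm n N)) :
    triMeanClusterSize_exponent :=
  triMeanClusterSize_exponent_of_separation (oneArm_exponent_of_scalingLimit' h₁ h₂)
    (fourArm_exponent_of_scalingLimit_of_nearCritical_separation L hlim hexp hsep) hsep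

end Literature.Probability.Percolation
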